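import Literature.AnabelianGeometry.SemiGraphs.ProfiniteSemiGraphIsoTransportCasts
import HarnessLib

/-!
# Composition of morphisms of semi-graphs of anabelioids in the local (profinite) presentation

Mochizuki, *Semi-graphs of anabelioids*, Publ. RIMS **42** (2006), §2, Def. 2.1 p. 22 (the semi-graph of
profinite groups `Π_v`, `Π_e`, `b_*`), Remark 2.4.2 p. 26: a morphism `φ : 𝒢 → ℋ` of semi-graphs of
anabelioids is a morphism of underlying semi-graphs together with 1-morphisms `φ_v`, `φ_e` of the
constituent anabelioids and, for every branch, an isomorphism `φ_b` between the two composite 1-morphisms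
`𝒢_e → ℋ_{φ(v)}` (the 2-cells); in print "the 1-morphisms from `𝒢` to `ℋ` form a category" (of which `φ` is
an object and whose morphisms are the 2-cells) — a 2-categorical statement about EACH Hom; the COMPOSITE
of two morphisms is formed from the composite 1-morphisms with the pasted 2-cells (audit note aud-18,
sheet `ref/SHEET-aud18-p495268.md`: the earlier header wording "the semi-graphs of anabelioids and their
morphisms form a category" mis-attached that quotation; corrected here, doc-only).  In the local
presentation: continuous homomorphisms of the constituent groups, compatible with the branch maps `b_*`
UP TO CONJUGATION [cite: MochizukiSemiAnbd2006, Rmk 2.4.2 p.26].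

The tree's §3 presentation `ProfiniteSemiGraph.Hom` (`TemperedVerticial.lean`) so far carried the identity
(`Hom.identity`, `SgATemperedArrows.lean`), the inverse of an isomorphism (`Hom.inverse`,
`ProfiniteSemiGraphIsoInverse.lean`) and restriction (`Hom.restrictSub`, `ProfiniteSemiGraphHomRestrict.lean`),
but NO composition (the §2 presentation `SemiGraphOfAnabelioids.Hom` has `HomComposition.lean`).  This
file is the §3 twin:

* `Hom.comp F G : Hom 𝒢 𝒦` for `F : Hom 𝒢 ℋ`, `G : Hom ℋ 𝒦` — base `F.base ≫ G.base` (`SemiGraph.Hom.comp`), constituents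
  `G_{F v} ∘ F_v`, `G_{F e} ∘ F_e`; the 2-cell at a branch `b ↦ v` is `G_{F v}(θ_F) · θ_G` (the casts along
  `edgeOf (F b) = F (edgeOf b)` are discharged with abc-iut-L3-d6's transport lemmas `castGe_castGe`,
  `Hom.hE_castGe`) — `Hom.comp_comm_of_conjugators` is that computation, once, for GIVEN conjugators;
* definitional bookkeeping (`comp_base`, `comp_vertexMap`, `comp_edgeMap`, `comp_branchMap`,
  `comp_hV_apply`, `comp_hE_apply`);
* `Hom.IsLocallyTrivial.comp`; `isIso_comp_base` (for `haveI`); local openness is NOT treated;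
* `Hom.ConjugatorFamily.comp θF θG` — the composite family of 2-cells as DATA (abc-iut-L3-d4's
  `ConjugatorFamily`), `θ_{b} := G_{F v}(θF_b) · θG_{F b}`, for the functoriality of the pull-back functors
  `(F ≫ G)^*_θ` (not done here).

DEFS-lane file (abc-iut cell, seat abc-iut-L3-d2 gen 6, row «COR311-EQUIVARIANCE⟸FUNCTORIALITY», brick (A));
consumer: `TemperedSpecialFibreCor311Equivariance.lean` (composition of Cor. 3.11-compatibilities).  No
instance, no notation, nothing of the paper is asserted; nothing here bears on [IUTchIII] Cor. 3.12.
-/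

noncomputable section

open CategoryTheory Topology

namespace Literature.AnabelianGeometry.SemiGraphs

namespace ProfiniteSemiGraph

universe u

variable {𝒢 ℋ 𝒦 : ProfiniteSemiGraph.{u}}

namespace Hom

/-! ### The 2-cells in transport (`castGe`) form -/

/-- The defining property of a family of conjugating elements, with the re-indexing along
`edgeOf (F b) = F (edgeOf b)` written as the transport `castGe` (abc-iut-L3-d6's
`ConjugatorFamily.comm_cast` at the tautological targets). [cite: MochizukiSemiAnbd2006, Rmk 2.4.2 p.26] -/
theorem ConjugatorFamily.spec_castGe {F : Hom 𝒢 ℋ} (θ : F.ConjugatorFamily) (b : 𝒢.graph.Branch)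
    (v : 𝒢.graph.Vertex) (h : 𝒢.graph.abuts b = some v) (x : 𝒢.Ge (𝒢.graph.edgeOf b)) :
    F.hV v (𝒢.brHom b v h x) = θ.θ b v h * ℋ.brHom (F.base.branchMap b) (F.base.vertexMap v)
      (F.base.abuts_branchMap b v h)
      (ℋ.castGe (F.base.edgeOf_branchMap b).symm (F.hE (𝒢.graph.edgeOf b) x)) * (θ.θ b v h)⁻¹ := by
  simpa only [castGv_rfl] using θ.comm_cast b v h rfl rfl (F.base.abuts_branchMap b v h) x

/-! ### The composite 2-cell -/

/-- **The pasted 2-cell of a composite** (Rmk. 2.4.2): if `θ_F ∈ Π_{F v}` conjugates `(F b)_* ∘ F_e` into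
`F_v ∘ b_*` and `θ_G ∈ Π_{G F v}` conjugates `(G F b)_* ∘ G_{e'}` into `G_{F v} ∘ (F b)_*` (`e' = edgeOf (F b)`),
then `G_{F v}(θ_F) · θ_G` conjugates `(G F b)_* ∘ (G_{F e} ∘ F_e)` into `(G_{F v} ∘ F_v) ∘ b_*` — all transports
along `edgeOf (F b) = F (edgeOf b)`, `edgeOf (G F b) = G F (edgeOf b)` written as `castGe`.
[cite: MochizukiSemiAnbd2006, Rmk 2.4.2 p.26] -/
theorem comp_comm_of_conjugators (F : Hom 𝒢 ℋ) (G : Hom ℋ 𝒦) (b : 𝒢.graph.Branch)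
    (v : 𝒢.graph.Vertex) (h : 𝒢.graph.abuts b = some v) (θF : ℋ.Gv (F.base.vertexMap v))
    (θG : 𝒦.Gv (G.base.vertexMap (F.base.vertexMap v)))
    (hF : ∀ x : 𝒢.Ge (𝒢.graph.edgeOf b),
      F.hV v (𝒢.brHom b v h x) = θF * ℋ.brHom (F.base.branchMap b) (F.base.vertexMap v)
        (F.base.abuts_branchMap b v h)
        (ℋ.castGe (F.base.edgeOf_branchMap b).symm (F.hE (𝒢.graph.edgeOf b) x)) * θF⁻¹)
    (hG : ∀ y : ℋ.Ge (ℋ.graph.edgeOf (F.base.branchMap b)),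
      G.hV (F.base.vertexMap v) (ℋ.brHom (F.base.branchMap b) (F.base.vertexMap v)
        (F.base.abuts_branchMap b v h) y) =
        θG * 𝒦.brHom (G.base.branchMap (F.base.branchMap b)) (G.base.vertexMap (F.base.vertexMap v))
          (G.base.abuts_branchMap _ _ (F.base.abuts_branchMap b v h))
          (𝒦.castGe (G.base.edgeOf_branchMap (F.base.branchMap b)).symm
            (G.hE (ℋ.graph.edgeOf (F.base.branchMap b)) y)) * θG⁻¹)
    (x : 𝒢.Ge (𝒢.graph.edgeOf b)) :
    G.hV (F.base.vertexMap v) (F.hV v (𝒢.brHom b v h x)) =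
      (G.hV (F.base.vertexMap v) θF * θG) *
        𝒦.brHom (G.base.branchMap (F.base.branchMap b)) (G.base.vertexMap (F.base.vertexMap v))
          (G.base.abuts_branchMap _ _ (F.base.abuts_branchMap b v h))
          (𝒦.castGe (e := G.base.edgeMap (F.base.edgeMap (𝒢.graph.edgeOf b)))
            (e' := 𝒦.graph.edgeOf (G.base.branchMap (F.base.branchMap b)))
            ((F.base.comp G.base).edgeOf_branchMap b).symm
            (G.hE (F.base.edgeMap (𝒢.graph.edgeOf b)) (F.hE (𝒢.graph.edgeOf b) x))) *
        (G.hV (F.base.vertexMap v) θF * θG)⁻¹ := by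
  rw [hF, map_mul, map_mul, map_inv, hG, G.hE_castGe, castGe_castGe]
  have hc : 𝒦.castGe ((congrArg G.base.edgeMap (F.base.edgeOf_branchMap b).symm).trans
        (G.base.edgeOf_branchMap (F.base.branchMap b)).symm)
        (G.hE (F.base.edgeMap (𝒢.graph.edgeOf b)) (F.hE (𝒢.graph.edgeOf b) x)) =
      𝒦.castGe (e := G.base.edgeMap (F.base.edgeMap (𝒢.graph.edgeOf b)))
        (e' := 𝒦.graph.edgeOf (G.base.branchMap (F.base.branchMap b)))
        ((F.base.comp G.base).edgeOf_branchMap b).symm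
        (G.hE (F.base.edgeMap (𝒢.graph.edgeOf b)) (F.hE (𝒢.graph.edgeOf b) x)) := rfl
  rw [hc, mul_inv_rev]
  simp only [mul_assoc]

/-! ### Composition -/

/-- **Composition of morphisms of semi-graphs of anabelioids** in the local presentation (Rmk. 2.4.2
p. 26: composite 1-morphisms of the constituents, 2-cells pasted): compose the morphisms of underlying
semi-graphs and the constituent homomorphisms; the compatibility with the branch maps up to conjugation
is witnessed by the pasted 2-cell `G_{F v}(θ_F) · θ_G` (`comp_comm_of_conjugators`).
[cite: MochizukiSemiAnbd2006, Rmk 2.4.2 p.26] -/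
def comp (F : Hom 𝒢 ℋ) (G : Hom ℋ 𝒦) : Hom 𝒢 𝒦 where
  base := F.base.comp G.base
  hV v := (G.hV (F.base.vertexMap v)).comp (F.hV v)
  hE e := (G.hE (F.base.edgeMap e)).comp (F.hE e)
  comm b v h := by
    obtain ⟨θF, hF⟩ := F.exists_comm_castGe b v h
    obtain ⟨θG, hG⟩ :=
      G.exists_comm_castGe (F.base.branchMap b) (F.base.vertexMap v) (F.base.abuts_branchMap b v h)
    refine ⟨G.hV (F.base.vertexMap v) θF * θG, fun x => ?_⟩
    rw [eqRec_eq_castGe ((F.base.comp G.base).edgeOf_branchMap b)]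
    exact comp_comm_of_conjugators F G b v h θF θG hF hG x

variable (F : Hom 𝒢 ℋ) (G : Hom ℋ 𝒦)

/-- The underlying morphism of semi-graphs of a composite is the composite.
[cite: MochizukiSemiAnbd2006, Rmk 2.4.2 p.26] -/
@[simp] theorem comp_base : (F.comp G).base = F.base.comp G.base := rfl

/-- The underlying morphism of semi-graphs of a composite is the composite in the category of
semi-graphs. [cite: MochizukiSemiAnbd2006, Rmk 2.4.2 p.26] -/
theorem comp_base_eq_categoryComp :
    (F.comp G).base = CategoryStruct.comp (obj := SemiGraph.{u}) F.base G.base := rfl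

/-- The underlying morphism of semi-graphs of a composite of morphisms whose underlying morphisms are
isomorphisms is an isomorphism (for `haveI`). [cite: MochizukiSemiAnbd2006, Rmk 2.4.2 p.26] -/
theorem isIso_comp_base [IsIso (C := SemiGraph.{u}) F.base] [IsIso (C := SemiGraph.{u}) G.base] :
    IsIso (C := SemiGraph.{u}) (F.comp G).base := by
  rw [comp_base_eq_categoryComp]
  infer_instance

/-- A composite acts on vertices by composition. [cite: MochizukiSemiAnbd2006, Rmk 2.4.2 p.26] -/
theorem comp_vertexMap (v : 𝒢.graph.Vertex) :
    (F.comp G).base.vertexMap v = G.base.vertexMap (F.base.vertexMap v) := rfl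

/-- A composite acts on edges by composition. [cite: MochizukiSemiAnbd2006, Rmk 2.4.2 p.26] -/
theorem comp_edgeMap (e : 𝒢.graph.Edge) :
    (F.comp G).base.edgeMap e = G.base.edgeMap (F.base.edgeMap e) := rfl

/-- A composite acts on branches by composition. [cite: MochizukiSemiAnbd2006, Rmk 2.4.2 p.26] -/
theorem comp_branchMap (b : 𝒢.graph.Branch) :
    (F.comp G).base.branchMap b = G.base.branchMap (F.base.branchMap b) := rfl

/-- The functions underlying the vertex map of a composite. [cite: MochizukiSemiAnbd2006, Rmk 2.4.2 p.26] -/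
theorem comp_vertexMap_eq : (F.comp G).base.vertexMap = G.base.vertexMap ∘ F.base.vertexMap := rfl

/-- The functions underlying the edge map of a composite. [cite: MochizukiSemiAnbd2006, Rmk 2.4.2 p.26] -/
theorem comp_edgeMap_eq : (F.comp G).base.edgeMap = G.base.edgeMap ∘ F.base.edgeMap := rfl

/-- The vertex homomorphisms of a composite are the composites `G_{F v} ∘ F_v`.
[cite: MochizukiSemiAnbd2006, Rmk 2.4.2 p.26] -/
@[simp] theorem comp_hV (v : 𝒢.graph.Vertex) :
    (F.comp G).hV v = (G.hV (F.base.vertexMap v)).comp (F.hV v) := rfl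

/-- The edge homomorphisms of a composite are the composites `G_{F e} ∘ F_e`.
[cite: MochizukiSemiAnbd2006, Rmk 2.4.2 p.26] -/
@[simp] theorem comp_hE (e : 𝒢.graph.Edge) :
    (F.comp G).hE e = (G.hE (F.base.edgeMap e)).comp (F.hE e) := rfl

/-- The vertex homomorphisms of a composite, evaluated. [cite: MochizukiSemiAnbd2006, Rmk 2.4.2 p.26] -/
theorem comp_hV_apply (v : 𝒢.graph.Vertex) (x : 𝒢.Gv v) :
    (F.comp G).hV v x = G.hV (F.base.vertexMap v) (F.hV v x) := rfl

/-- The edge homomorphisms of a composite, evaluated. [cite: MochizukiSemiAnbd2006, Rmk 2.4.2 p.26] -/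
theorem comp_hE_apply (e : 𝒢.graph.Edge) (x : 𝒢.Ge e) :
    (F.comp G).hE e x = G.hE (F.base.edgeMap e) (F.hE e x) := rfl

/-- Composition with the identity on the left does not change the underlying morphism of semi-graphs.
[cite: MochizukiSemiAnbd2006, Rmk 2.4.2 p.26] -/
@[simp] theorem identity_comp_base : ((Hom.identity 𝒢).comp F).base = F.base := rfl

/-- Composition with the identity on the right does not change the underlying morphism of semi-graphs.
[cite: MochizukiSemiAnbd2006, Rmk 2.4.2 p.26] -/
@[simp] theorem comp_identity_base : (F.comp (Hom.identity ℋ)).base = F.base := rfl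

/-- Composition is associative on underlying morphisms of semi-graphs.
[cite: MochizukiSemiAnbd2006, Rmk 2.4.2 p.26] -/
theorem comp_assoc_base {𝒮 : ProfiniteSemiGraph.{u}} (H : Hom 𝒦 𝒮) :
    ((F.comp G).comp H).base = (F.comp (G.comp H)).base := rfl

/-! ### Local triviality and local openness compose -/

/-- Locally trivial morphisms compose (isomorphisms of profinite groups compose).
[cite: MochizukiSemiAnbd2006, Def 2.2(ii) p.24] -/
theorem IsLocallyTrivial.comp {F : Hom 𝒢 ℋ} {G : Hom ℋ 𝒦} (hF : F.IsLocallyTrivial)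
    (hG : G.IsLocallyTrivial) : (F.comp G).IsLocallyTrivial :=
  ⟨fun v => (hG.1 (F.base.vertexMap v)).comp (hF.1 v), fun e => (hG.2 (F.base.edgeMap e)).comp (hF.2 e)⟩

/-- The identity composed with itself is locally trivial (sanity check of the bookkeeping).
[cite: MochizukiSemiAnbd2006, Def 2.2(ii) p.24] -/
theorem identity_comp_identity_isLocallyTrivial (𝒢 : ProfiniteSemiGraph.{u}) :
    ((Hom.identity 𝒢).comp (Hom.identity 𝒢)).IsLocallyTrivial :=
  (Hom.identity_isLocallyTrivial 𝒢).comp (Hom.identity_isLocallyTrivial 𝒢)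

/-! ### Composite families of 2-cells -/

/-- **The composite family of conjugating elements** (pasting of 2-cells, Rmk. 2.4.2): for families
`θF` of `F` and `θG` of `G`, the family `b ↦ G_{F v}(θF_b) · θG_{F b}` of `F ≫ G`.
[cite: MochizukiSemiAnbd2006, Rmk 2.4.2 p.26] -/
def ConjugatorFamily.comp {F : Hom 𝒢 ℋ} {G : Hom ℋ 𝒦} (θF : F.ConjugatorFamily)
    (θG : G.ConjugatorFamily) : (F.comp G).ConjugatorFamily where
  θ b v h := G.hV (F.base.vertexMap v) (θF.θ b v h) *
    θG.θ (F.base.branchMap b) (F.base.vertexMap v) (F.base.abuts_branchMap b v h)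
  spec b v h x := by
    rw [show ((F.comp G).hV v).comp (𝒢.brHom b v h) x =
        G.hV (F.base.vertexMap v) (F.hV v (𝒢.brHom b v h x)) from rfl,
      comp_comm_of_conjugators F G b v h _ _ (θF.spec_castGe b v h)
        (θG.spec_castGe (F.base.branchMap b) (F.base.vertexMap v) (F.base.abuts_branchMap b v h)) x]
    congr 2
    change 𝒦.brHomAt _ _ _ _ ((F.base.comp G.base).edgeOf_branchMap b) ((F.comp G).hE _ x) = _
    rw [brHomAt_apply, eqRec_eq_castGe ((F.base.comp G.base).edgeOf_branchMap b)]
    rfl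

/-- The composite family, evaluated. [cite: MochizukiSemiAnbd2006, Rmk 2.4.2 p.26] -/
@[simp] theorem ConjugatorFamily.comp_θ {F : Hom 𝒢 ℋ} {G : Hom ℋ 𝒦} (θF : F.ConjugatorFamily)
    (θG : G.ConjugatorFamily) (b : 𝒢.graph.Branch) (v : 𝒢.graph.Vertex)
    (h : 𝒢.graph.abuts b = some v) :
    (θF.comp θG).θ b v h = G.hV (F.base.vertexMap v) (θF.θ b v h) *
      θG.θ (F.base.branchMap b) (F.base.vertexMap v) (F.base.abuts_branchMap b v h) := rfl

end Hom

end ProfiniteSemiGraph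

end Literature.AnabelianGeometry.SemiGraphs

end
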